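import Summits.Ventures.HodgeRepro2.T5SU11JacobiWeightRecursion
import Summits.Ventures.HodgeRepro2.T5SU11JacobiIntegerWeight

/-!
# The two-step recursion re-derives the weight-`5` and weight-`6` transforms from weights `3` and `4`

Two independent routes to the integer-weight transforms: the Pochhammer / reflection route of
`T5SU11JacobiIntegerWeight` (weight `5`: `2π(1−λ)(1+λ)(3−λ)/(9 cos(πλ/2))`; weight `6`:
`π² λ(2−λ)(2+λ)(4−λ)/(64 sin(πλ/2))`) and the two-step recursion `m̂_{k+2} = r_k(λ) m̂_k` of
`T5SU11JacobiWeightRecursion` applied to the elementary weight-`3` and weight-`4` values of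
`T5SU11JacobiThreeFour` (`2π(1−λ)/cos(πλ/2)`, `π²λ(2−λ)/(4 sin(πλ/2))`). With
`r_3(λ) = (3−λ)(1+λ)/9` and `r_4(λ) = (4−λ)(2+λ)/16` the two routes agree exactly
(`weight_five_by_recursion`, `weight_five_cross_check`, `weight_six_by_recursion`, `weight_six_cross_check`),
and the recursion gives every odd weight from weight `3` and every even weight from weight `4` in product
form (`weight_odd_by_recursion`, `weight_even_by_recursion`). Nothing is claimed about (N).

Blind lane: Mathlib + the HodgeRepro2 prefix only; no sorry; axioms ⊆ {propext, Classical.choice,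
Quot.sound}.
-/

namespace Summit.Ventures.HodgeRepro2.T5SU11JacobiRecursionCrossCheck

open MeasureTheory MeasureTheory.Measure Metric Set Filter Topology Finset
open T5SU11Unimodular T5SU11Fibration T5SU11Cartan T5HaarCircle T5BergmanCoefficient
  T5SU11FibrationHaar T5SU11SphericalFunction T5SU11SphericalSymmetry T5SU11SphericalBounds
  T5SU11SphericalContinuous T5SU11JacobiIwasawa T5SU11JacobiTransform T5SU11JacobiWeight
  T5SU11KFiniteMajorantPow T5SU11JacobiDuplication T5SU11JacobiWeightRecursion T5SU11JacobiThreeFour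
  T5SU11JacobiIntegerWeight
open scoped Real

/-- `r_3(λ) = (3 − λ)(1 + λ)/9`. -/
theorem weightRatio_three (lam : ℝ) : weightRatio 3 lam = (3 - lam) * (1 + lam) / 9 := by
  unfold weightRatio
  ring

/-- `r_4(λ) = (4 − λ)(2 + λ)/16`. -/
theorem weightRatio_four (lam : ℝ) : weightRatio 4 lam = (4 - lam) * (2 + lam) / 16 := by
  unfold weightRatio
  ring

/-- The weight-`5` identity of rational functions, proved directly. -/
theorem weight_five_cross_check' {lam : ℝ} (_hc : Real.cos (π * lam / 2) ≠ 0) :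
    (3 - lam) * (1 + lam) / 9 * (2 * π * (1 - lam) / Real.cos (π * lam / 2))
      = 2 * π * (1 - lam) * (1 + lam) * (3 - lam) / (9 * Real.cos (π * lam / 2)) := by
  field_simp

/-- The weight-`6` identity of rational functions, proved directly. -/
theorem weight_six_cross_check' {lam : ℝ} (_hs : Real.sin (π * lam / 2) ≠ 0) :
    (4 - lam) * (2 + lam) / 16 * (π ^ 2 * lam * (2 - lam) / (4 * Real.sin (π * lam / 2)))
      = π ^ 2 * lam * (2 - lam) * (2 + lam) * (4 - lam) / (64 * Real.sin (π * lam / 2)) := by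
  field_simp
  ring

section measure

variable [MeasurableSpace Circle] [BorelSpace Circle]

/-- **Weight `5` by the recursion**: `m̂_5(λ) = ((3 − λ)(1 + λ)/9) · 2π(1 − λ)/cos(πλ/2)` for `−1 < λ < 3`,
`λ ≠ 1`. -/
theorem weight_five_by_recursion {lam : ℝ} (h1 : -1 < lam) (h2 : lam < 3) (h3 : lam ≠ 1) :
    ∫ g, (1 - ‖orbit g‖ ^ 2) ^ ((5 : ℝ) / 2) * sph lam g ∂(nu haarCircle)
      = (3 - lam) * (1 + lam) / 9 * (2 * π * (1 - lam) / Real.cos (π * lam / 2)) := by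
  rw [show (5 : ℝ) / 2 = (3 + 2) / 2 by norm_num,
    jacobi_weight_add_two (by norm_num) (by linarith) (by linarith), weightRatio_three,
    integral_orbit_rpow_three_mul_sph h1 h2 h3]

/-- **Cross-check**: the recursion value agrees with the Pochhammer value of `T5SU11JacobiIntegerWeight`
on the common domain. -/
theorem weight_five_cross_check {lam : ℝ} (h1 : -1 < lam) (h2 : lam < 3) (h3 : lam ≠ 1)
    (hc : Real.cos (π * lam / 2) ≠ 0) :
    (3 - lam) * (1 + lam) / 9 * (2 * π * (1 - lam) / Real.cos (π * lam / 2))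
      = 2 * π * (1 - lam) * (1 + lam) * (3 - lam) / (9 * Real.cos (π * lam / 2)) := by
  rw [← weight_five_by_recursion h1 h2 h3,
    integral_orbit_rpow_five_mul_sph (by linarith) (by linarith) hc]

/-- **Weight `6` by the recursion**: `m̂_6(λ) = ((4 − λ)(2 + λ)/16) · π²λ(2 − λ)/(4 sin(πλ/2))` for `0 < λ < 4`,
`λ ≠ 2`. -/
theorem weight_six_by_recursion {lam : ℝ} (h1 : 0 < lam) (h2 : lam < 4) (h3 : lam ≠ 2) :
    ∫ g, (1 - ‖orbit g‖ ^ 2) ^ ((6 : ℝ) / 2) * sph lam g ∂(nu haarCircle)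
      = (4 - lam) * (2 + lam) / 16 * (π ^ 2 * lam * (2 - lam) / (4 * Real.sin (π * lam / 2))) := by
  rw [show (6 : ℝ) / 2 = (4 + 2) / 2 by norm_num,
    jacobi_weight_add_two (by norm_num) (by linarith) (by linarith), weightRatio_four,
    integral_orbit_rpow_four_mul_sph h1 h2 h3]

/-- **Cross-check** at weight `6` against `T5SU11JacobiIntegerWeight`. -/
theorem weight_six_cross_check {lam : ℝ} (h1 : 0 < lam) (h2 : lam < 4) (h3 : lam ≠ 2)
    (hs : Real.sin (π * lam / 2) ≠ 0) :
    (4 - lam) * (2 + lam) / 16 * (π ^ 2 * lam * (2 - lam) / (4 * Real.sin (π * lam / 2)))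
      = π ^ 2 * lam * (2 - lam) * (2 + lam) * (4 - lam) / (64 * Real.sin (π * lam / 2)) := by
  rw [← weight_six_by_recursion h1 h2 h3,
    integral_orbit_rpow_six_mul_sph (by linarith) (by linarith) hs]

/-- **Every odd weight from weight `3`**: `m̂_{3+2n}(λ) = (∏_{i<n} r_{3+2i}(λ)) · 2π(1 − λ)/cos(πλ/2)` for
`−1 < λ < 3`, `λ ≠ 1`. -/
theorem weight_odd_by_recursion {lam : ℝ} (h1 : -1 < lam) (h2 : lam < 3) (h3 : lam ≠ 1) (n : ℕ) :
    ∫ g, (1 - ‖orbit g‖ ^ 2) ^ ((3 + 2 * n : ℝ) / 2) * sph lam g ∂(nu haarCircle)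
      = (∏ i ∈ range n, weightRatio (3 + 2 * i) lam) * (2 * π * (1 - lam) / Real.cos (π * lam / 2)) := by
  rw [jacobi_weight_add_two_mul (by norm_num) (by linarith) (by linarith) n,
    integral_orbit_rpow_three_mul_sph h1 h2 h3]

/-- **Every even weight from weight `4`**: `m̂_{4+2n}(λ) = (∏_{i<n} r_{4+2i}(λ)) · π²λ(2 − λ)/(4 sin(πλ/2))`
for `0 < λ < 4`, `λ ≠ 2`. -/
theorem weight_even_by_recursion {lam : ℝ} (h1 : 0 < lam) (h2 : lam < 4) (h3 : lam ≠ 2) (n : ℕ) :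
    ∫ g, (1 - ‖orbit g‖ ^ 2) ^ ((4 + 2 * n : ℝ) / 2) * sph lam g ∂(nu haarCircle)
      = (∏ i ∈ range n, weightRatio (4 + 2 * i) lam)
        * (π ^ 2 * lam * (2 - lam) / (4 * Real.sin (π * lam / 2))) := by
  rw [jacobi_weight_add_two_mul (by norm_num) (by linarith) (by linarith) n,
    integral_orbit_rpow_four_mul_sph h1 h2 h3]

end measure

end Summit.Ventures.HodgeRepro2.T5SU11JacobiRecursionCrossCheck
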